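import Summits.CriticalPhenomena.PercolationContinuityZ3.Theorems.PercNearOneGluingNoHeavyQuantFarBlockOutsideExit
import HarnessLib

/-!
# QUANT lane R8, front "FAR beyond trees", layer one — the INTRINSIC (environment-universal) criterion for a pendant block, I:
# the arithmetic core, the first-moment count of the outside relays, Harris inside the block

builds on p205010 (kernel theorem, internal audit signed; external expert review pending)

Support file (`--supports stmt-CriticalPhenomena-4575`), seat `prim-quant-p1` (gen 24); memo
`run/shared/lean/prim/quant/prim-quant-p1-g24/FOR-LEAD-INTRINSIC.md`.  Standard axioms; no sorries; no definitions.  Companion (part II, the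
graph-level theorems): `…QuantFarBlockIntrinsic`.

SETTING (as in `…QuantFarBlockLaw` / `…BlockTransfer` / `…BlockEnvExit`, p1 g19/g23).  A block `Z` hangs at the cut vertex `c` of a finite
weighted graph `w` (`o, c ∉ Z`, `w` vanishes between `Z` and `(Z ∪ {c})ᶜ`); relays `A`; `X = #{a ∈ A ∩ Z : c ↔ a on Z}` with block numbers
`h_S = P(X ≥ 1)`, `t_S = P(X ≥ 2)`; internal marginals `τ_a = P(c ↔ a on Z)`, inside mean `M_in = Σ_{a ∈ A ∩ Z} τ_a`; environment coefficients
`A₀ = P(#out ≥ 2)`, `B = P(#out = 1 ∧ o ↔ c off Z)`, `C = P(#out = 0 ∧ o ↔ c off Z)`, `g = P(o ↔ c off Z)`, `P₁ = P(#out = 1)` (`#out` = number of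
relays of `A ∖ Z` joined to `o` off `Z`), so that `P_w(N ≥ 2) = A₀ + B·h_S + C·t_S` (`Block.real_two_le_card_eq`).

THE ARGUMENT (part II assembles it).  With `x = 1 − t ≤` every relay marginal, `Σ = Σ_{a ∉ Z} P(o ↔ a)`, `K = |A ∖ Z|`:
`A₀ + B + C ≥ g` (mass of `J`), Harris `(P₁ + A₀)·g ≤ A₀ + B` (p1 g23), the count `K x ≤ Σ ≤ P₁ + K·A₀` (so `Σ·A₀ ≥ (Σ − P₁)·x`), `EN = Σ + g·M_in > 2`
and `x ≤ g τ₀` imply `x ≤ A₀ + B h + C d` for every `0 ≤ d ≤ h`, `d ≤ 1` with (B1) `τ₀²(1−d) ≤ 2d(1−τ₀)` and (B2) `τ₀(1−d) ≤ d(1−τ₀) + (h−d)(2−M_in)`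
(`Block.intrinsic_arith`: case `A₀ ≥ x` by the mass of `J`; else the count bounds `A₀` below by `x(1 − P₁/Σ)`, Harris bounds `B` below by
`g P₁ − (1−g)x`, and the remaining inequality is affine in `P₁ ∈ [(1−g)τ₀, Σ]` and in `g`, with end values (B1), (B2)).
* `Block.intrinsic_arith` — the real-arithmetic core.
* `Block.sum_real_le_one_add_card_mul_two` — `Σ_k μ(E_k) ≤ μ(#{k : E_k} = 1) + |s|·μ(#{k : E_k} ≥ 2)` and `μ(# = 1) ≤ Σ_k μ(E_k)`.
* `Block.onZ_mono`, `Block.isUpperSet_onZ_openConn`, `Block.real_blockTwo_ge_mul` — Harris inside the block: `τ_{a₀} τ_{a₁} ≤ t_S`.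
[cite: Grimmett1999, §1.3 p. 10; Thm. (2.4) p. 34] (product measure, Harris); the theorems [this work].
-/

noncomputable section

namespace Summit.CriticalPhenomena.PercolationContinuityZ3.Theorems

namespace Quant

namespace Block

open Finset MeasureTheory Set
open Literature.Probability.LatticeModels
open Literature.Probability.Percolation
open Bundle (offZ avoid offZ_subset real_offZ_event_eq_of_agree)
open scoped Classical

variable {n : ℕ} {o c : Fin n} {Z : Finset (Fin n)}

/-! ## The arithmetic core -/

/-- **Arithmetic core of the intrinsic criterion.**  Reals: environment `A₀, B, C, P₁, g`, outside sum `Σ` over `K` outside relays (`K` enters only through `Kx ≤ Σ ≤ P₁ + K A₀`), threshold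
`x = 1 − t`, block `τ ≤ M ≤ 2`, `0 ≤ d ≤ h`, `d ≤ 1`.  Hypotheses: `g ≤ A₀ + B + C`, Harris `(P₁ + A₀)g ≤ A₀ + B`, `Kx ≤ Σ ≤ P₁ + K A₀`, `P₁ ≤ Σ`,
`2 < Σ + gM`, `x ≤ gτ`, (B1) `τ²(1−d) ≤ 2d(1−τ)`, (B2) `τ(1−d) ≤ d(1−τ) + (h−d)(2−M)`.  Conclusion: `x ≤ A₀ + B h + C d`. [this work] -/
theorem intrinsic_arith {A0 B C P1 Sig K g x τ h d M : ℝ}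
    (hA0 : 0 ≤ A0) (hB : 0 ≤ B) (hC : 0 ≤ C) (hP1 : 0 ≤ P1)
    (hg0 : 0 ≤ g) (hg1 : g ≤ 1) (hτ0 : 0 ≤ τ) (hτ1 : τ ≤ 1) (hd0 : 0 ≤ d) (hdh : d ≤ h) (hd1 : d ≤ 1)
    (hτM : τ ≤ M) (hM : M ≤ 2)
    (hJ : g ≤ A0 + B + C) (hHar : (P1 + A0) * g ≤ A0 + B)
    (hKx : K * x ≤ Sig) (hSig : Sig ≤ P1 + K * A0) (hP1S : P1 ≤ Sig) (hEN : 2 < Sig + g * M) (hx : x ≤ g * τ)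
    (hB1 : τ ^ 2 * (1 - d) ≤ 2 * d * (1 - τ)) (hB2 : τ * (1 - d) ≤ d * (1 - τ) + (h - d) * (2 - M)) :
    x ≤ A0 + B * h + C * d := by
  rcases le_or_gt x 0 with hxnp | hxpos
  · have : 0 ≤ B * h := mul_nonneg hB (hd0.trans hdh)
    have : 0 ≤ C * d := mul_nonneg hC hd0
    linarith
  have hgx : x ≤ g := hx.trans (mul_le_of_le_one_right hg0 hτ1)
  have hgM : g * M ≤ M := mul_le_of_le_one_left (hτ0.trans hτM) hg1
  have hSpos : 0 < Sig := by linarith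
  -- step 1: `A₀ + B h + C d ≥ A₀(1−d) + g d + B(h−d)`
  have hstep : A0 * (1 - d) + g * d + B * (h - d) ≤ A0 + B * h + C * d := by
    have h1 : (g - A0 - B) * d ≤ C * d := mul_le_mul_of_nonneg_right (by linarith) hd0
    have h2 : A0 * (1 - d) + g * d + B * (h - d) = A0 + B * h + (g - A0 - B) * d := by ring
    rw [h2]; linarith only [h1]
  refine le_trans ?_ hstep
  rcases le_or_gt x A0 with hA0x | hA0x
  · -- `A₀ ≥ x`: `A₀(1−d) + g d ≥ x(1−d) + x d = x`
    have e1 : x * (1 - d) ≤ A0 * (1 - d) := mul_le_mul_of_nonneg_right hA0x (by linarith)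
    have e2 : x * d ≤ g * d := mul_le_mul_of_nonneg_right hgx hd0
    have e3 : 0 ≤ B * (h - d) := mul_nonneg hB (by linarith)
    have e4 : x = x * (1 - d) + x * d := by ring
    rw [e4]; linarith only [e1, e2, e3]
  -- `A₀ < x`: the counting bound `Σ·A₀ ≥ (Σ − P₁)·x` and the Harris bound `B ≥ g P₁ − (1−g) x`
  have hcount : (Sig - P1) * x ≤ Sig * A0 := by
    have e1 : (Sig - P1) * x ≤ K * A0 * x := mul_le_mul_of_nonneg_right (by linarith) hxpos.le
    have e2 : K * x * A0 ≤ Sig * A0 := mul_le_mul_of_nonneg_right hKx hA0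
    have e3 : K * A0 * x = K * x * A0 := by ring
    linarith only [e1, e2, e3]
  have hBlow : g * P1 - (1 - g) * x ≤ B := by
    have : (1 - g) * A0 ≤ (1 - g) * x := mul_le_mul_of_nonneg_left hA0x.le (by linarith)
    linarith
  -- the (B1)-consequence used in both sub-cases: `Σ d (1−τ) ≥ (1−g) τ² (1−d)`
  have hK1 : (1 - g) * τ ^ 2 * (1 - d) ≤ Sig * d * (1 - τ) := by
    have e1 : (2 - g * M) * (d * (1 - τ)) ≤ Sig * (d * (1 - τ)) :=
      mul_le_mul_of_nonneg_right (by linarith) (mul_nonneg hd0 (by linarith))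
    -- `(2 − gM) d(1−τ) − (1−g)τ²(1−d) = (1−g)[2d(1−τ) − τ²(1−d)] + g(2−M)d(1−τ) ≥ 0`
    have e2 : 0 ≤ (1 - g) * (2 * d * (1 - τ) - τ ^ 2 * (1 - d)) := mul_nonneg (by linarith) (by linarith)
    have e3 : 0 ≤ g * ((2 - M) * (d * (1 - τ))) := mul_nonneg hg0 (mul_nonneg (by linarith) (mul_nonneg hd0 (by linarith)))
    have e4 : (2 - g * M) * (d * (1 - τ)) - (1 - g) * τ ^ 2 * (1 - d) =
        (1 - g) * (2 * d * (1 - τ) - τ ^ 2 * (1 - d)) + g * ((2 - M) * (d * (1 - τ))) := by ring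
    have e5 : Sig * (d * (1 - τ)) = Sig * d * (1 - τ) := by ring
    linarith only [e1, e2, e3, e4, e5]
  by_cases hP1τ : P1 ≤ (1 - g) * τ
  · -- sub-case (i'): drop `B`; need `A₀(1−d) + g d ≥ x`, i.e. (×Σ) `Σ(g d − x d) ≥ P₁ x (1−d)` after the counting bound
    have e0 : 0 ≤ B * (h - d) := mul_nonneg hB (by linarith)
    suffices hsuf : Sig * x ≤ Sig * (A0 * (1 - d) + g * d) by
      have := le_of_mul_le_mul_left hsuf hSpos
      linarith
    have e1 : (Sig - P1) * x * (1 - d) ≤ Sig * A0 * (1 - d) := mul_le_mul_of_nonneg_right hcount (by linarith)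
    -- `P₁ x (1−d) ≤ (1−g)τ · gτ(1−d)` and `Σ x d ≤ Σ g τ d`
    have e2 : P1 * (x * (1 - d)) ≤ (1 - g) * τ * (x * (1 - d)) :=
      mul_le_mul_of_nonneg_right hP1τ (mul_nonneg hxpos.le (by linarith))
    have e3 : (1 - g) * τ * (x * (1 - d)) ≤ (1 - g) * τ * (g * τ * (1 - d)) :=
      mul_le_mul_of_nonneg_left (mul_le_mul_of_nonneg_right hx (by linarith)) (mul_nonneg (by linarith) hτ0)
    have e4 : Sig * (x * d) ≤ Sig * (g * τ * d) :=
      mul_le_mul_of_nonneg_left (mul_le_mul_of_nonneg_right hx hd0) hSpos.le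
    have e5 : g * ((1 - g) * τ ^ 2 * (1 - d)) ≤ g * (Sig * d * (1 - τ)) := mul_le_mul_of_nonneg_left hK1 hg0
    have e6 : Sig * x = (Sig - P1) * x * (1 - d) + Sig * (x * d) + P1 * (x * (1 - d)) := by ring
    have e7 : Sig * (A0 * (1 - d) + g * d) = Sig * A0 * (1 - d) + Sig * (g * τ * d) + g * (Sig * d * (1 - τ)) := by ring
    have e8 : (1 - g) * τ * (g * τ * (1 - d)) = g * ((1 - g) * τ ^ 2 * (1 - d)) := by ring
    rw [e6, e7]; linarith only [e1, e2, e3, e4, e5, e8]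
  · have hP1τ : (1 - g) * τ < P1 := lt_of_not_ge hP1τ
    -- sub-case (ii'): `B(h−d) ≥ g(P₁ − (1−g)τ)(h−d) ≥ 0`
    have hBlow' : g * (P1 - (1 - g) * τ) ≤ B := by
      have e1 : (1 - g) * x ≤ (1 - g) * (g * τ) := mul_le_mul_of_nonneg_left hx (by linarith)
      have e2 : g * (P1 - (1 - g) * τ) = g * P1 - (1 - g) * (g * τ) := by ring
      linarith only [hBlow, e1, e2]
    have e0 : g * (P1 - (1 - g) * τ) * (h - d) ≤ B * (h - d) := mul_le_mul_of_nonneg_right hBlow' (by linarith)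
    suffices hsuf : Sig * x ≤ Sig * (A0 * (1 - d) + g * d + g * (P1 - (1 - g) * τ) * (h - d)) by
      have := le_of_mul_le_mul_left hsuf hSpos
      linarith
    have e1 : (Sig - P1) * x * (1 - d) ≤ Sig * A0 * (1 - d) := mul_le_mul_of_nonneg_right hcount (by linarith)
    -- reduce to `Φ(P₁) := Σ d(1−τ) + Σ(P₁ − (1−g)τ)(h−d) − P₁ τ (1−d) ≥ 0` after `x ≤ gτ`
    have e2 : Sig * (x * d) ≤ Sig * (g * τ * d) :=
      mul_le_mul_of_nonneg_left (mul_le_mul_of_nonneg_right hx hd0) hSpos.le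
    have e3 : P1 * (x * (1 - d)) ≤ P1 * (g * τ * (1 - d)) :=
      mul_le_mul_of_nonneg_left (mul_le_mul_of_nonneg_right hx (by linarith)) hP1
    -- `Φ` is affine in `P₁ ∈ [(1−g)τ, Σ]`; both end values are `≥ 0`
    have hΦlo : 0 ≤ Sig * d * (1 - τ) - (1 - g) * τ * (τ * (1 - d)) := by
      have : (1 - g) * τ * (τ * (1 - d)) = (1 - g) * τ ^ 2 * (1 - d) := by ring
      linarith only [hK1, this]
    have hΦhi : 0 ≤ d * (1 - τ) + (Sig - (1 - g) * τ) * (h - d) - τ * (1 - d) := by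
      -- `Σ ≥ 2 − gM`, and `2 − gM − (1−g)τ = (1−g)(2−τ) + g(2−M)`
      have f1 : (2 - g * M - (1 - g) * τ) * (h - d) ≤ (Sig - (1 - g) * τ) * (h - d) :=
        mul_le_mul_of_nonneg_right (by linarith) (by linarith)
      have f2 : 0 ≤ (1 - g) * (d * (1 - τ) + (2 - τ) * (h - d) - τ * (1 - d)) := by
        have f21 : (2 - M) * (h - d) ≤ (2 - τ) * (h - d) := mul_le_mul_of_nonneg_right (by linarith) (by linarith)
        have f22 : (h - d) * (2 - M) = (2 - M) * (h - d) := by ring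
        exact mul_nonneg (by linarith) (by linarith only [hB2, f21, f22])
      have f3 : 0 ≤ g * (d * (1 - τ) + (2 - M) * (h - d) - τ * (1 - d)) := by
        have f31 : (h - d) * (2 - M) = (2 - M) * (h - d) := by ring
        exact mul_nonneg hg0 (by linarith only [hB2, f31])
      have f4 : d * (1 - τ) + (2 - g * M - (1 - g) * τ) * (h - d) - τ * (1 - d) =
          (1 - g) * (d * (1 - τ) + (2 - τ) * (h - d) - τ * (1 - d)) + g * (d * (1 - τ) + (2 - M) * (h - d) - τ * (1 - d)) := by
        ring
      have f5 : 0 ≤ d * (1 - τ) + (2 - g * M - (1 - g) * τ) * (h - d) - τ * (1 - d) := by rw [f4]; exact add_nonneg f2 f3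
      linarith only [f1, f5]
    have hΦ : 0 ≤ Sig * d * (1 - τ) + Sig * (P1 - (1 - g) * τ) * (h - d) - P1 * τ * (1 - d) := by
      -- write `P₁ = (1−g)τ + u` with `0 ≤ u ≤ Σ − (1−g)τ`
      by_cases hsl : 0 ≤ Sig * (h - d) - τ * (1 - d)
      · have f1 : 0 ≤ (P1 - (1 - g) * τ) * (Sig * (h - d) - τ * (1 - d)) := mul_nonneg (sub_nonneg.2 hP1τ.le) hsl
        have f2 : Sig * d * (1 - τ) + Sig * (P1 - (1 - g) * τ) * (h - d) - P1 * τ * (1 - d) =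
            (P1 - (1 - g) * τ) * (Sig * (h - d) - τ * (1 - d)) + (Sig * d * (1 - τ) - (1 - g) * τ * (τ * (1 - d))) := by ring
        rw [f2]; exact add_nonneg f1 hΦlo
      · have hsl' : Sig * (h - d) - τ * (1 - d) < 0 := lt_of_not_ge hsl
        have f1 : 0 ≤ (Sig - P1) * (τ * (1 - d) - Sig * (h - d)) := mul_nonneg (sub_nonneg.2 hP1S) (by linarith)
        have hh : 0 ≤ Sig * (d * (1 - τ) + (Sig - (1 - g) * τ) * (h - d) - τ * (1 - d)) := mul_nonneg hSpos.le hΦhi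
        have f2 : Sig * d * (1 - τ) + Sig * (P1 - (1 - g) * τ) * (h - d) - P1 * τ * (1 - d) =
            (Sig - P1) * (τ * (1 - d) - Sig * (h - d)) + Sig * (d * (1 - τ) + (Sig - (1 - g) * τ) * (h - d) - τ * (1 - d)) := by
          ring
        rw [f2]; exact add_nonneg f1 hh
    have e5 : 0 ≤ g * (Sig * d * (1 - τ) + Sig * (P1 - (1 - g) * τ) * (h - d) - P1 * τ * (1 - d)) := mul_nonneg hg0 hΦ
    have e6 : Sig * x = (Sig - P1) * x * (1 - d) + Sig * (x * d) + P1 * (x * (1 - d)) := by ring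
    have e7 : Sig * (A0 * (1 - d) + g * d + g * (P1 - (1 - g) * τ) * (h - d)) =
        Sig * A0 * (1 - d) + Sig * (g * τ * d) + P1 * (g * τ * (1 - d)) +
          g * (Sig * d * (1 - τ) + Sig * (P1 - (1 - g) * τ) * (h - d) - P1 * τ * (1 - d)) := by ring
    rw [e6, e7]; linarith only [e1, e2, e3, e5]

/-! ## First-moment counting: `Σ_k P(E_k) ≤ P(exactly one) + |s|·P(at least two)` -/

/-- **First-moment count.**  For events `E k`, `k ∈ s`, of bond configurations and a finite measure:
`Σ_{k∈s} μ(E k) ≤ μ(#{k : E k} = 1) + |s|·μ(#{k : E k} ≥ 2)` and `μ(#{k : E k} = 1) ≤ Σ_{k∈s} μ(E k)`. [folklore; first-moment counting] -/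
theorem sum_real_le_one_add_card_mul_two (μ : Measure (BondConfig (Fin n))) [IsFiniteMeasure μ] {κ : Type*} (s : Finset κ)
    (E : κ → Set (BondConfig (Fin n))) :
    ∑ k ∈ s, μ.real (E k) ≤ μ.real {ω | (s.filter fun k => ω ∈ E k).card = 1} +
        s.card * μ.real {ω | 2 ≤ (s.filter fun k => ω ∈ E k).card} ∧
      μ.real {ω | (s.filter fun k => ω ∈ E k).card = 1} ≤ ∑ k ∈ s, μ.real (E k) := by
  have hmeas : ∀ U : Set (BondConfig (Fin n)), MeasurableSet U := fun U => (Set.toFinite U).measurableSet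
  set S1 : Set (BondConfig (Fin n)) := {ω | (s.filter fun k => ω ∈ E k).card = 1} with hS1
  set S2 : Set (BondConfig (Fin n)) := {ω | 2 ≤ (s.filter fun k => ω ∈ E k).card} with hS2
  have hint : ∀ k ∈ s, Integrable ((E k).indicator fun _ => (1 : ℝ)) μ :=
    fun k _ => (integrable_const (1 : ℝ)).indicator (hmeas _)
  have h1 : ∀ k ∈ s, μ.real (E k) = ∫ ω, (E k).indicator (fun _ => (1 : ℝ)) ω ∂μ := by
    intro k _
    rw [integral_indicator_const _ (hmeas _), smul_eq_mul, mul_one]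
  have hsum : ∑ k ∈ s, μ.real (E k) = ∫ ω, (∑ k ∈ s, (E k).indicator (fun _ => (1 : ℝ)) ω) ∂μ := by
    rw [Finset.sum_congr rfl h1, ← integral_finsetSum s hint]
  have hcard : ∀ ω, (∑ k ∈ s, (E k).indicator (fun _ => (1 : ℝ)) ω) = ((s.filter fun k => ω ∈ E k).card : ℝ) := by
    intro ω
    rw [Finset.natCast_card_filter]
    refine Finset.sum_congr rfl fun k _ => ?_
    by_cases hk : ω ∈ E k
    · rw [if_pos hk, Set.indicator_of_mem hk]
    · rw [if_neg hk, Set.indicator_of_notMem hk]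
  have hi1 : Integrable (S1.indicator fun _ => (1 : ℝ)) μ := (integrable_const (1 : ℝ)).indicator (hmeas _)
  have hi2 : Integrable (S2.indicator fun _ => (s.card : ℝ)) μ := (integrable_const (s.card : ℝ)).indicator (hmeas _)
  have hS1i : μ.real S1 = ∫ ω, S1.indicator (fun _ => (1 : ℝ)) ω ∂μ := by
    rw [integral_indicator_const _ (hmeas _), smul_eq_mul, mul_one]
  have hS2i : (s.card : ℝ) * μ.real S2 = ∫ ω, S2.indicator (fun _ => (s.card : ℝ)) ω ∂μ := by
    rw [integral_indicator_const _ (hmeas _), smul_eq_mul, mul_comm]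
  constructor
  · rw [hsum, hS1i, hS2i, ← integral_add hi1 hi2]
    refine integral_mono (integrable_finsetSum s hint) (hi1.add hi2) fun ω => ?_
    simp only [hcard ω]
    by_cases h2 : 2 ≤ (s.filter fun k => ω ∈ E k).card
    · have hω2 : ω ∈ S2 := h2
      have hω1 : ω ∉ S1 := by simp only [hS1, mem_setOf_eq]; omega
      rw [Set.indicator_of_mem hω2, Set.indicator_of_notMem hω1, zero_add]
      exact_mod_cast Finset.card_filter_le _ _
    · have hω2 : ω ∉ S2 := h2
      rw [Set.indicator_of_notMem hω2, add_zero]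
      by_cases h1' : (s.filter fun k => ω ∈ E k).card = 1
      · have hω1 : ω ∈ S1 := h1'
        rw [Set.indicator_of_mem hω1, h1']; simp
      · have hω1 : ω ∉ S1 := h1'
        rw [Set.indicator_of_notMem hω1]
        have : (s.filter fun k => ω ∈ E k).card = 0 := by omega
        rw [this]; simp
  · rw [hsum, hS1i]
    refine integral_mono hi1 (integrable_finsetSum s hint) fun ω => ?_
    simp only [hcard ω]
    by_cases h1' : (s.filter fun k => ω ∈ E k).card = 1
    · have hω1 : ω ∈ S1 := h1'
      rw [Set.indicator_of_mem hω1, h1']; simp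
    · have hω1 : ω ∉ S1 := h1'
      rw [Set.indicator_of_notMem hω1]; positivity

/-! ## Harris inside the block: `t_S ≥ τ₀ τ₁` -/

/-- `onZ Z` is monotone in the configuration. [this work] -/
theorem onZ_mono (Z : Finset (Fin n)) {ω ω' : BondConfig (Fin n)} (h : ω ≤ ω') : onZ Z ω ≤ onZ Z ω' :=
  fun _ he => ⟨h he.1, he.2⟩

/-- `{ω | onZ Z ω ∈ openConn x y}` is an increasing event. [this work] -/
theorem isUpperSet_onZ_openConn (Z : Finset (Fin n)) (x y : Fin n) :
    IsUpperSet {ω : BondConfig (Fin n) | onZ Z ω ∈ openConn x y} :=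
  fun _ _ hle h => isUpperSet_openConn x y (onZ_mono Z hle) h

/-- **Harris inside the block**: for two distinct block relays `a₀ ≠ a₁` of `A ∩ Z`, `τ_{a₀}·τ_{a₁} ≤ P(X ≥ 2)`. [this work] -/
theorem real_blockTwo_ge_mul (w : Sym2 (Fin n) → unitInterval) (A : Finset (Fin n)) {a₀ a₁ : Fin n}
    (ha₀ : a₀ ∈ A ∩ Z) (ha₁ : a₁ ∈ A ∩ Z) (hne : a₀ ≠ a₁) :
    (prodBernoulli w).real {ω | onZ Z ω ∈ openConn c a₀} * (prodBernoulli w).real {ω | onZ Z ω ∈ openConn c a₁} ≤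
      (prodBernoulli w).real {ω | 2 ≤ ((A ∩ Z).filter fun a => onZ Z ω ∈ openConn c a).card} := by
  have hmeas : ∀ U : Set (BondConfig (Fin n)), MeasurableSet U := fun U => (Set.toFinite U).measurableSet
  refine le_trans (prodBernoulli_harris w (isUpperSet_onZ_openConn Z c a₀) (isUpperSet_onZ_openConn Z c a₁) (hmeas _) (hmeas _)) ?_
  refine measureReal_mono (fun ω hω => ?_) (measure_ne_top _ _)
  simp only [Set.mem_inter_iff, mem_setOf_eq] at hω ⊢
  have hsub : ({a₀, a₁} : Finset (Fin n)) ⊆ (A ∩ Z).filter fun a => onZ Z ω ∈ openConn c a := by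
    intro a ha
    simp only [Finset.mem_insert, Finset.mem_singleton] at ha
    rcases ha with rfl | rfl
    · exact Finset.mem_filter.2 ⟨ha₀, hω.1⟩
    · exact Finset.mem_filter.2 ⟨ha₁, hω.2⟩
  exact le_trans (by rw [Finset.card_pair hne]) (Finset.card_le_card hsub)

end Block

end Quant

end Summit.CriticalPhenomena.PercolationContinuityZ3.Theorems
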